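import Summits.BirchSwinnertonDyer.BirchSwinnertonDyer.Theorems.Rank1ResidualX9Defs
import Literature.NumberTheory.EllipticCurves.Rank1Residual.MuLeFineMuCarrier
import HarnessLib
import HarnessLib.Audit

/-!
# ES-C6 «the `μ` of the Selmer group is FINE on class X9»: `μ(X(E/ℚ_∞)) ≤ μ(X₀(E/ℚ_∞))` at every X9
# pair — the `e = 0` coordinate of the Euler-system lens's `(δ, e, c)` chart (OPEN; nothing asserted)

HONEST FRAMING (cell `bsd-f3-mu`, D-0131 (3) FRONTIER TIER, HOME `run/shared/lean/pub/bsd-f3-mu/`).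
TYPER's filing of the `-es` lens's generation-5 candidate ES-C6 (MEMO-es §26, `HOME/es/Sketch6.lean`
sha16 f03ae372678c37c1, rc 0; refuter `-ref1` seventh pass (REF1-AUDIT §3.8): SURVIVES, BC7 3/3 CLEAN;
refuter `-ref2` g7 (REF2-LITMAP row es-C6): for irreducible `E[p]` the statement is Ray 2023 Conj. 5.3 at
`(E[p], F̄⁺)` — OPEN, not refuted in print; falsifier `es/falsifier_c6.out` 4853d2395ceae8e9 on
X9-MU-TABLE-v1 361f587418fce70d: 834/848 X9 rows decided TRUE mod F1 (every certified row: `μ_an = 0` ⟹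
`μ_alg = 0` ⟹ `e = 0`), 0 refuting, open regime `μ_an ≥ 1`: 0 rows).  A pure CONJECTURE LEAF over the
Literature carrier `Rank1Residual.MuLeFineMuAt` (`Rank1Residual/MuLeFineMuCarrier.lean`); edges in
`MuLeFineMuEdges.lean`.

THE CHART (MEMO-es §9; Kato §17.13 modulo F1).  `μ(L_p) = δ + e + c` (`δ` = global divisibility of the
zeta class — node ES-C2 `EulerPrimitiveOnClassX9` is «δ = 0»; `e` = saturation of `loc_p : 𝐇¹ → P`; `c` =
Coleman cokernel) and `μ(X) = e + μ(X₀)`; ES-C6 is «`e = 0`».  For irreducible `E[p]` it is Ray's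
Conj. 5.3 (finiteness of the residual quotient `S_{E[p]}(ℚ_∞)/S⁰_{E[p]}(ℚ_∞)`), = the desc lens's K2
(unit half) in E-intrinsic form; OFF the irreducible locus it is FALSE (`(X₀(11), 5)`), so the `ClassX9`
guard is load-bearing.  With it: Greenberg-X9 ⟺ ConjA-X9 ∧ ES-C6 (edges (e1″)/(e2′)); ES-C2 ∧ ES-C6 ⟹
`μ = 0` on X9 (e3); ES-C6 ⟹ DESC-C1 (e4); K1 ∧ ES-C6 ⟹ `μ = 0` on X9 (e5).
PARTITION currency unchanged: X9 790 = 130 (5Ns) + 36 (7Ns) + 624 (5S4) (+58 r ≥ 2); X10b 883 = 610 + 273.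

References: [Kato2004Asterisque] §17.13, Thm. 12.4; [Ray2023] Conj. 5.3, Thm. 5.4, Cor. 5.5;
[CoatesSujatha2005] §3, Thm. 3.4; [GreenbergLNM1716] Conj. 1.11; [DeoRaySujatha2023] p. 3; HOME
MEMO-es.md §9, §26, es/Sketch6.lean, REF1-AUDIT.md §3.8, REF2-LITMAP.md row es-C6, CANDIDATES.md §1 row 24.
-/

-- the summit and its single problem are both named `BirchSwinnertonDyer` (registry layout D-0017)
set_option linter.dupNamespace false

noncomputable section

open scoped Classical

open WeierstrassCurve Literature.NumberTheory.EllipticCurves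
  Summit.BirchSwinnertonDyer.BirchSwinnertonDyer.Rank1Residual
open Literature.NumberTheory.EllipticCurves.Rank1Residual (MuLeFineMuAt)

namespace Summit.BirchSwinnertonDyer.Rank1Residual.SmallImageMu

/-- **ES-C6 — `μ` is fine on class X9 (OPEN off the certified census; cell candidate; nothing
asserted).**  At every X9 pair (`p ≥ 5` good ordinary, `E[p]` irreducible, `ρ̄` not surjective, non-CM):
`Rank1Residual.MuLeFineMuAt W p`, i.e. `μ(D.X) ≤ μ(Y.X)` for every dual Selmer datum `D` and every
finitely generated torsion dual fine datum `Y` over the same cyclotomic data — the saturation `e = 0` of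
the global-to-singular localisation at `p` (mod F1).  Equivalent for irreducible `E[p]` to Ray's
Conj. 5.3 for `(E[p], F̄⁺)`; = the desc lens's K2 in E-intrinsic form.  FALSE off the irreducible locus
(`(X₀(11), 5)`).  Verbatim the audited `HOME/es/Sketch6.lean`.
[cite: Ray2023, Conj. 5.3, Thm. 5.4, Cor. 5.5 (arXiv:2308.06673 pp. 4, 13) — OPEN]
[cite: Kato2004Asterisque, §17.13 (pp. 279–280) — the chart] -/
@[conjecture] def MuLeFineMuOnClassX9 : Prop :=
  ∀ (W : WeierstrassCurve ℚ) [W.IsElliptic] [W.IsGloballyMinimal] (p : ℕ) [Fact p.Prime],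
    ClassX9 W p → MuLeFineMuAt W p

end Summit.BirchSwinnertonDyer.Rank1Residual.SmallImageMu

end
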